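import Mathlib.NumberTheory.LSeries.RiemannZeta
import Mathlib.NumberTheory.EulerProduct.DirichletLSeries
import Mathlib.NumberTheory.Padics.PadicNorm
import Mathlib.Analysis.SpecialFunctions.Pow.Deriv
import Mathlib.Analysis.Calculus.Deriv.Slope
import Mathlib.Analysis.Analytic.Order
import Mathlib.Analysis.Analytic.IsolatedZeros
import Mathlib.Analysis.Complex.CauchyIntegral
import Mathlib.LinearAlgebra.Matrix.Determinant.Basic
import HarnessLib

/-!
# The `S`-class number formula at `s = 0` for `ℚ`: `ζ_{ℚ,S}(s) ∼ −(h_S R_S / w)·s^{|S|−1}`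

For a number field `k` and a finite set `S` of places containing the archimedean ones, Tate
[Tate1984Stark, Ch. I §2] writes `ζ_{k,S}(s) = ∏_{𝔭 ∉ S} (1 − N𝔭^{−s})^{−1}` (the zeta function of the
Dedekind ring `𝒪_S` of `S`-integers), `h_S` for the class number of `𝒪_S`, `R_S` for the
`S`-regulator (`R_S = |det (log |u_i|_v)_{1 ≤ i ≤ r, v ∈ S ∖ {v₀}}|` for a basis `u_1, …, u_r` of
`𝒪_S^×` modulo torsion, `r = card S − 1`, `v₀ ∈ S` arbitrary) and `e` (= `w`) for the number of roots
of unity of `k`, and proves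

* **Lemme 2.1 (iii)**: for `𝔭 ∉ S` and `S' = S ∪ {𝔭}`, `ζ_{k,S'}(s) ∼ (log N𝔭)·s·ζ_{k,S}(s)` at `s = 0`;
* **Corollaire 2.2**: `ζ_{k,S}(s) ∼ −(h_S R_S / e)·s^{card S − 1}` at `s = 0`

(`f ∼ g` meaning `f/g → 1`), generalising Cor. 1.2 (`S = S_∞`: the Taylor expansion of `ζ_k` at `0`
starts with `−(hR/e) s^{r₁+r₂−1}`). Tran [Tran2016WeilEtale, Thm 1.1, Prop 4.8] re-derives the same
leading term as (minus) the Weil-étale Euler characteristic `χ_U(ℤ) = h_S R_S / w` of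
`U = Spec 𝒪_{K,S}`; his Prop 5.3 is the local statement `ord_{s=0} (1 − N𝔭^{−s})^{−1} = −1` with
leading coefficient `1/log N𝔭`.

This file proves the case `k = ℚ` completely, from Mathlib:

* `zetaRatS S` — `ζ_{ℚ,S}` for `S = {∞} ∪ S_f`, `S_f` a finite set of rational primes (the argument of
  the definition), as the meromorphic function `ζ(s)·∏_{p ∈ S_f}(1 − p^{−s})` on all of `ℂ`;
  `hasProd_zetaRatS` identifies it with Tate's Euler product `∏_{p ∉ S_f}(1 − p^{−s})^{−1}` on
  `Re s > 1`, and `zetaRatS_insert` is the algebraic form of Lemme 2.1 (iii).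
* `tendsto_one_sub_natCast_cpow_neg_div` — the local factor at `s = 0`:
  `(1 − p^{−s})/s → log p` (Lemme 2.1 (iii) / Tran Prop 5.3 for `M = ℤ`).
* `tendsto_zetaRatS_div_pow_card` — **Cor. 2.2 for `k = ℚ`**:
  `ζ_{ℚ,S}(s)/s^{|S_f|} → −½·∏_{p ∈ S_f} log p` as `s → 0`, `s ≠ 0`; the limit is non-zero
  (`zetaRatS_leadingCoeff_ne_zero`).
* `analyticOrderAt_zetaRatS_zero` — `ζ_{ℚ,S}` is analytic at `0` with a zero of order EXACTLY
  `|S_f| = card S − 1` (`= rank ℤ[1/S_f]^×`, the first half of Cor. 2.2 / of Tran's Thm 1.1), via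
  Mathlib's `analyticOrderAt`: `ζ(0) = −½ ≠ 0` has order `0`, each removed Euler factor
  `1 − p^{−s}` has order `1` (`analyticOrderAt_one_sub_natCast_cpow_neg`), orders add.
* `sUnitRegulatorMatrix S` — Tate's matrix `(log |u_i|_v)` for the `S`-units `u_p = p` (`p ∈ S_f`;
  together with `−1` they generate `ℤ[1/S_f]^× = ±∏_{p ∈ S_f} p^ℤ`) and `v` running over the finite
  places `S ∖ {∞}`, with entries COMPUTED from the `p`-adic absolute values
  (`log |p|_q = 0` for primes `p ≠ q`, `log |p|_p = −log p`): it is `−diag(log p)`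
  (`sUnitRegulatorMatrix_eq_diagonal`), so `R_S = |det| = ∏_{p ∈ S_f} log p`
  (`sUnitRegulator_eq_prod_log`).
* `tendsto_zetaRatS_classNumberFormula` — the leading coefficient in Tate's shape
  `−h_S R_S / w` with `h_S = 1` (`ℤ[1/S_f]` is a principal ideal domain) and `w = 2` (`±1`):
  `ζ_{ℚ,S}(s)/s^{|S_f|} → −R_S/2`.

What is NOT here: general number fields (Dedekind zeta residue/class number formula is not in
Mathlib at this pin), the `S`-unit theorem as a statement about `(Localization …)ˣ`, and the
Weil-étale cohomology groups themselves (Tran §2–4); only the analytic identity they compute is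
formalised. Motivation: these are exactly the numbers carried by the finite-level "Weil-étale
`S`-integer" cells `Y = Spec ℤ[1/S_f]`, `S_f = {2}, {2,3}, …, {2,…,13}` of the RH construction
census (value `ζ*_Y(0) = −½∏ log p`, regulator block `−diag(log p)`, `ord_{s=0} = |S_f|`).
-/

namespace Literature.NumberTheory.LFunctions

open Filter Complex
open scoped _root_.Topology BigOperators

/-! ## The `S`-truncated zeta function of `ℚ` -/

/-- `ζ_{ℚ,S}(s)` for `S = {∞} ∪ S_f`, `S_f ⊂ {primes}` finite (the argument `S` of this definition is
`S_f`): the Riemann zeta function with the Euler factors at `p ∈ S_f` removed,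
`ζ_{ℚ,S}(s) = ζ(s)·∏_{p ∈ S_f} (1 − p^{−s})`, as a function on all of `ℂ` (Mathlib's `riemannZeta`,
so the value at the pole `s = 1` is a junk value). On `Re s > 1` it is Tate's
`∏_{p ∉ S}(1 − Np^{−s})^{−1}`, the zeta function of the Dedekind ring `ℤ[1/S_f]`
(`hasProd_zetaRatS`). [cite: Tate1984Stark, Ch. I §2 (definition of ζ_{k,S}), p. 22] -/
noncomputable def zetaRatS (S : Finset ℕ) (s : ℂ) : ℂ :=
  riemannZeta s * ∏ p ∈ S, (1 - (p : ℂ) ^ (-s))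

/-- Unfolding lemma for `zetaRatS`. [cite: Tate1984Stark, Ch. I §2, p. 22] -/
theorem zetaRatS_def (S : Finset ℕ) (s : ℂ) :
    zetaRatS S s = riemannZeta s * ∏ p ∈ S, (1 - (p : ℂ) ^ (-s)) := rfl

/-- `S_f = ∅`: `ζ_{ℚ,{∞}} = ζ`. [cite: Tate1984Stark, Ch. I §2, p. 22] -/
@[simp] theorem zetaRatS_empty (s : ℂ) : zetaRatS ∅ s = riemannZeta s := by
  simp [zetaRatS]

/-- Tate's Lemme 2.1 (iii) in algebraic form for `k = ℚ`: enlarging `S` by a prime `p ∉ S`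
multiplies `ζ_{ℚ,S}` by the inverse Euler factor `1 − p^{−s}`.
[cite: Tate1984Stark, Ch. I §2 Lemme 2.1 (iii), p. 22] -/
theorem zetaRatS_insert {S : Finset ℕ} {p : ℕ} (hp : p ∉ S) (s : ℂ) :
    zetaRatS (insert p S) s = (1 - (p : ℂ) ^ (-s)) * zetaRatS S s := by
  classical
  simp only [zetaRatS, Finset.prod_insert hp]
  ring

/-- **Euler product.** For `Re s > 1` and `S_f` a finite set of primes, `ζ_{ℚ,S}(s)` is the
convergent product over the primes NOT in `S_f` of `(1 − p^{−s})^{−1}` — Tate's definition of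
`ζ_{k,S}` for `k = ℚ` (the factor at `p ∈ S_f` is `1`).
[cite: Tate1984Stark, Ch. I §2 (definition of ζ_{k,S}), p. 22] -/
theorem hasProd_zetaRatS {s : ℂ} (hs : 1 < s.re) (S : Finset ℕ) (hS : ∀ p ∈ S, p.Prime) :
    HasProd (fun p : Nat.Primes => if (p : ℕ) ∈ S then (1 : ℂ) else (1 - (p : ℂ) ^ (-s))⁻¹)
      (zetaRatS S s) := by
  classical
  -- the finitely supported correction `h` killing the Euler factors at `p ∈ S_f`
  set h : Nat.Primes → ℂ := fun p => if (p : ℕ) ∈ S then (1 - (p : ℂ) ^ (-s)) else 1 with hh_def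
  have hh : HasProd h (∏ p ∈ S.subtype Nat.Prime, h p) := by
    refine hasProd_prod_of_ne_finset_one fun p hp => ?_
    have : (p : ℕ) ∉ S := fun hmem => hp (Finset.mem_subtype.mpr hmem)
    simp [hh_def, this]
  have hprod : ∏ p ∈ S.subtype Nat.Prime, h p = ∏ p ∈ S, (1 - (p : ℂ) ^ (-s)) := by
    have h1 : ∏ p ∈ S.subtype Nat.Prime, h p
        = ∏ p ∈ S.subtype Nat.Prime, (fun n : ℕ => (1 - (n : ℂ) ^ (-s))) (p : ℕ) := by
      refine Finset.prod_congr rfl fun p hp => ?_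
      have : (p : ℕ) ∈ S := Finset.mem_subtype.mp hp
      simp [hh_def, this]
    rw [h1, Finset.prod_subtype_of_mem (fun n : ℕ => (1 - (n : ℂ) ^ (-s))) hS]
  have hζ := (riemannZeta_eulerProduct_hasProd hs).mul hh
  rw [hprod] at hζ
  refine (hζ.congr_fun ?_ : HasProd _ (zetaRatS S s))
  intro p
  by_cases hp : (p : ℕ) ∈ S
  · have hne : 1 - (p : ℂ) ^ (-s) ≠ 0 := one_sub_prime_cpow_ne_zero p.2 hs
    simp [hh_def, hp, inv_mul_cancel₀ hne]
  · simp [hh_def, hp]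

/-! ## The local factor at `s = 0` -/

/-- `s ↦ 1 − p^{−s}` has derivative `log p` at `s = 0` (`p ≥ 1`). [folklore] -/
private theorem hasDerivAt_one_sub_natCast_cpow_neg {p : ℕ} (hp : 0 < p) :
    HasDerivAt (fun s : ℂ => 1 - (p : ℂ) ^ (-s)) (Real.log p) 0 := by
  have hp' : (p : ℂ) ≠ 0 := by exact_mod_cast hp.ne'
  have h1 : HasDerivAt (fun s : ℂ => (p : ℂ) ^ (-s))
      ((p : ℂ) ^ (-(0 : ℂ)) * Complex.log p * (-1)) 0 :=
    ((hasDerivAt_id (0 : ℂ)).neg).const_cpow (Or.inl hp')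
  refine (h1.const_sub 1).congr_deriv ?_
  rw [neg_zero, Complex.cpow_zero, one_mul, mul_neg_one, neg_neg, Complex.natCast_log]

/-- **The Euler factor at a finite place, at `s = 0`**: `(1 − p^{−s})/s → log p` as `s → 0`
(`s ≠ 0`), i.e. `ord_{s=0}(1 − Np^{−s})^{−1} = −1` with leading coefficient `1/log Np` — Tate's
Lemme 2.1 (iii) `ζ_{k,S∪{𝔭}}(s) ∼ (log N𝔭)·s·ζ_{k,S}(s)`, equivalently Tran's Prop. 5.3 for `M = ℤ`.
[cite: Tate1984Stark, Ch. I §2 Lemme 2.1 (iii), p. 22] -/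
theorem tendsto_one_sub_natCast_cpow_neg_div {p : ℕ} (hp : 0 < p) :
    Tendsto (fun s : ℂ => (1 - (p : ℂ) ^ (-s)) / s) (𝓝[≠] 0) (𝓝 (Real.log p : ℂ)) := by
  have h := hasDerivAt_iff_tendsto_slope_zero.mp (hasDerivAt_one_sub_natCast_cpow_neg hp)
  refine h.congr fun t => ?_
  simp only [zero_add, neg_zero, Complex.cpow_zero, sub_self, sub_zero, smul_eq_mul]
  rw [inv_mul_eq_div]

/-! ## Cor. 2.2 for `k = ℚ`: order of vanishing and leading coefficient at `s = 0` -/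

/-- **Tate's Cor. 2.2 for `k = ℚ`.** For a finite set `S_f` of positive integers (primes in the
application), `ζ_{ℚ,S}(s)/s^{|S_f|} → −½·∏_{p ∈ S_f} log p` as `s → 0`, `s ≠ 0`: the Taylor
expansion of `ζ_{ℚ,S}` at `0` starts with `−(h_S R_S/w)·s^{card S − 1}`, here with `ζ(0) = −½`,
`card S − 1 = |S_f|`. [cite: Tate1984Stark, Ch. I §2 Cor. 2.2, pp. 22–23] -/
theorem tendsto_zetaRatS_div_pow_card (S : Finset ℕ) (hS : ∀ p ∈ S, 0 < p) :
    Tendsto (fun s : ℂ => zetaRatS S s / s ^ S.card) (𝓝[≠] 0)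
      (𝓝 (-(∏ p ∈ S, (Real.log p : ℂ)) / 2)) := by
  have hζ : Tendsto riemannZeta (𝓝[≠] (0 : ℂ)) (𝓝 (-1 / 2)) := by
    have hc := (differentiableAt_riemannZeta (s := 0) (by norm_num)).continuousAt.tendsto
    rw [riemannZeta_zero] at hc
    exact hc.mono_left nhdsWithin_le_nhds
  have hP : Tendsto (fun s : ℂ => ∏ p ∈ S, (1 - (p : ℂ) ^ (-s)) / s) (𝓝[≠] 0)
      (𝓝 (∏ p ∈ S, (Real.log p : ℂ))) :=
    tendsto_finsetProd S fun p hp => tendsto_one_sub_natCast_cpow_neg_div (hS p hp)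
  have h := hζ.mul hP
  have hlim : (-1 / 2 : ℂ) * ∏ p ∈ S, (Real.log p : ℂ) = -(∏ p ∈ S, (Real.log p : ℂ)) / 2 := by
    ring
  rw [hlim] at h
  refine h.congr fun s => ?_
  rw [zetaRatS, Finset.prod_div_distrib, Finset.prod_const, mul_div_assoc]

/-- The leading coefficient `−½∏_{p ∈ S_f} log p` is non-zero when `S_f` consists of primes, so
`ord_{s=0} ζ_{ℚ,S} = |S_f| = card S − 1` exactly (`= rank ℤ[1/S_f]^×` by Dirichlet's
`S`-unit theorem for `ℚ`). [cite: Tate1984Stark, Ch. I §2 Cor. 2.2, pp. 22–23] -/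
theorem zetaRatS_leadingCoeff_ne_zero (S : Finset ℕ) (hS : ∀ p ∈ S, p.Prime) :
    (-(∏ p ∈ S, (Real.log p : ℂ)) / 2) ≠ 0 := by
  have hprod : ∏ p ∈ S, (Real.log p : ℂ) ≠ 0 := by
    rw [Finset.prod_ne_zero_iff]
    intro p hp
    have h1 : (1 : ℝ) < p := by exact_mod_cast (hS p hp).one_lt
    exact_mod_cast (Real.log_pos h1).ne'
  simpa using hprod

/-- In particular `ζ_{ℚ,S}` does not vanish on a punctured neighbourhood of `0`, and vanishes AT
`0` as soon as `S_f ≠ ∅` (a zero of exact order `|S_f|`). [cite: Tate1984Stark, Ch. I §2 Cor. 2.2, pp. 22–23] -/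
theorem zetaRatS_zero_eq_zero {S : Finset ℕ} (hS : S.Nonempty) : zetaRatS S 0 = 0 := by
  obtain ⟨p, hp⟩ := hS
  rw [zetaRatS, Finset.prod_eq_zero hp] <;> simp

/-- `ζ_{ℚ,S}(s) ≠ 0` for all `s ≠ 0` close to `0` (`S_f` a set of primes).
[cite: Tate1984Stark, Ch. I §2 Cor. 2.2, pp. 22–23] -/
theorem eventually_zetaRatS_ne_zero (S : Finset ℕ) (hS : ∀ p ∈ S, p.Prime) :
    ∀ᶠ s in 𝓝[≠] (0 : ℂ), zetaRatS S s ≠ 0 := by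
  have h := (tendsto_zetaRatS_div_pow_card S fun p hp => (hS p hp).pos).eventually_ne
    (zetaRatS_leadingCoeff_ne_zero S hS)
  filter_upwards [h] with s hs
  intro h0
  exact hs (by simp [h0])

/-! ## The order of vanishing at `s = 0` as an analytic order -/

/-- `ζ` is analytic at `s = 0` (it is differentiable on the open set `{1}ᶜ`). [folklore] -/
private theorem analyticAt_riemannZeta_zero : AnalyticAt ℂ riemannZeta 0 := by
  have hd : DifferentiableOn ℂ riemannZeta {1}ᶜ := fun z hz =>
    (differentiableAt_riemannZeta hz).differentiableWithinAt
  exact hd.analyticAt (isOpen_compl_singleton.mem_nhds (by simp))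

/-- The inverse Euler factor `s ↦ 1 − p^{−s}` (`p ≥ 1`) is entire. [folklore] -/
private theorem analyticAt_one_sub_natCast_cpow_neg {p : ℕ} (hp : 0 < p) (z : ℂ) :
    AnalyticAt ℂ (fun s : ℂ => 1 - (p : ℂ) ^ (-s)) z := by
  have hp' : (p : ℂ) ≠ 0 := by exact_mod_cast hp.ne'
  have hd : Differentiable ℂ (fun s : ℂ => 1 - (p : ℂ) ^ (-s)) := fun w =>
    (differentiableAt_const _).sub ((differentiableAt_id.neg).const_cpow (Or.inl hp'))
  exact hd.analyticAt z

/-- The inverse Euler factor `1 − p^{−s}` (`p > 1`) has a SIMPLE zero at `s = 0`: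
`ord_{s=0}(1 − Np^{−s})^{−1} = −1` (Tate, Lemme 2.1 (iii); Tran, Prop. 5.3 with `r_v(ℤ) = 1`).
[cite: Tate1984Stark, Ch. I §2 Lemme 2.1 (iii), p. 22] -/
theorem analyticOrderAt_one_sub_natCast_cpow_neg {p : ℕ} (hp : 1 < p) :
    analyticOrderAt (fun s : ℂ => 1 - (p : ℂ) ^ (-s)) 0 = 1 := by
  set f : ℂ → ℂ := fun s : ℂ => 1 - (p : ℂ) ^ (-s) with hf_def
  have hf : AnalyticAt ℂ f 0 := analyticAt_one_sub_natCast_cpow_neg (by omega) 0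
  have hderiv : deriv f 0 = Real.log p := (hasDerivAt_one_sub_natCast_cpow_neg (by omega)).deriv
  rw [← ENat.coe_one, hf.analyticOrderAt_eq_natCast]
  obtain ⟨q, hq⟩ := hf
  refine ⟨dslope f 0, ⟨_, hq.has_fpower_series_dslope_fslope⟩, ?_, ?_⟩
  · rw [dslope_same, hderiv]
    have h1 : (1 : ℝ) < p := by exact_mod_cast hp
    exact_mod_cast (Real.log_pos h1).ne'
  · refine Filter.Eventually.of_forall fun z => ?_
    have h := sub_smul_dslope f 0 z
    have hf0 : f 0 = 0 := by simp [hf_def]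
    rw [sub_zero, hf0, sub_zero] at h
    rw [sub_zero, pow_one, h]

/-- The product of the removed Euler factors `∏_{p ∈ S_f}(1 − p^{−s})` is analytic at `0` with a
zero of order exactly `|S_f|` (orders add). [cite: Tate1984Stark, Ch. I §2 Lemme 2.1 (iii), p. 22] -/
theorem analyticOrderAt_prod_one_sub_natCast_cpow_neg (S : Finset ℕ) (hS : ∀ p ∈ S, p.Prime) :
    AnalyticAt ℂ (fun s : ℂ => ∏ p ∈ S, (1 - (p : ℂ) ^ (-s))) 0 ∧
      analyticOrderAt (fun s : ℂ => ∏ p ∈ S, (1 - (p : ℂ) ^ (-s))) 0 = S.card := by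
  classical
  induction S using Finset.induction_on with
  | empty =>
    refine ⟨?_, ?_⟩
    · simp only [Finset.prod_empty]
      exact analyticAt_const
    · simp only [Finset.prod_empty, Finset.card_empty, CharP.cast_eq_zero]
      exact analyticAt_const.analyticOrderAt_eq_zero.mpr one_ne_zero
  | insert a S ha ih =>
    have hS' : ∀ p ∈ S, p.Prime := fun p hp => hS p (Finset.mem_insert_of_mem hp)
    have haP : a.Prime := hS a (Finset.mem_insert_self a S)
    obtain ⟨hanS, hordS⟩ := ih hS'
    have hfa : AnalyticAt ℂ (fun s : ℂ => 1 - (a : ℂ) ^ (-s)) 0 :=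
      analyticAt_one_sub_natCast_cpow_neg haP.pos 0
    have heq : (fun s : ℂ => ∏ p ∈ insert a S, (1 - (p : ℂ) ^ (-s)))
        = (fun s : ℂ => 1 - (a : ℂ) ^ (-s)) * (fun s : ℂ => ∏ p ∈ S, (1 - (p : ℂ) ^ (-s))) := by
      funext s
      simp [Finset.prod_insert ha]
    rw [heq]
    refine ⟨hfa.mul hanS, ?_⟩
    rw [analyticOrderAt_mul hfa hanS, hordS, analyticOrderAt_one_sub_natCast_cpow_neg haP.one_lt,
      Finset.card_insert_of_notMem ha]
    push_cast
    rw [add_comm]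

/-- `ζ_{ℚ,S}` is analytic at `s = 0`. [cite: Tate1984Stark, Ch. I §2, p. 22] -/
theorem analyticAt_zetaRatS_zero (S : Finset ℕ) (hS : ∀ p ∈ S, p.Prime) :
    AnalyticAt ℂ (zetaRatS S) 0 := by
  have heq : zetaRatS S = riemannZeta * fun s : ℂ => ∏ p ∈ S, (1 - (p : ℂ) ^ (-s)) := by
    funext s; rfl
  rw [heq]
  exact analyticAt_riemannZeta_zero.mul (analyticOrderAt_prod_one_sub_natCast_cpow_neg S hS).1

/-- **Order of vanishing (Tate Cor. 2.2, `r = card S − 1`; Tran Thm 1.1, `ord_{s=0} = rank of the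
units) for `k = ℚ`.** `ζ_{ℚ,S}` has a zero of order EXACTLY `|S_f|` at `s = 0`
(`|S_f| = card S − 1 = rank ℤ[1/S_f]^×`): `ζ(0) = −½` contributes order `0` and each removed Euler
factor a simple zero. [cite: Tate1984Stark, Ch. I §2 Cor. 2.2, pp. 22–23] -/
theorem analyticOrderAt_zetaRatS_zero (S : Finset ℕ) (hS : ∀ p ∈ S, p.Prime) :
    analyticOrderAt (zetaRatS S) 0 = S.card := by
  obtain ⟨han, hord⟩ := analyticOrderAt_prod_one_sub_natCast_cpow_neg S hS
  have heq : zetaRatS S = riemannZeta * fun s : ℂ => ∏ p ∈ S, (1 - (p : ℂ) ^ (-s)) := by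
    funext s; rfl
  have hζ0 : analyticOrderAt riemannZeta 0 = 0 :=
    analyticAt_riemannZeta_zero.analyticOrderAt_eq_zero.mpr (by rw [riemannZeta_zero]; norm_num)
  rw [heq, analyticOrderAt_mul analyticAt_riemannZeta_zero han, hord, hζ0, zero_add]

/-! ## The `S`-regulator of `ℚ` -/

/-- Tate's regulator matrix `(log |u_i|_v)_{i, v}` for `k = ℚ`, `S = {∞} ∪ S_f`, with the omitted
place `v₀ = ∞`, the `S`-units `u_p = p` (`p ∈ S_f`; with `−1` they generate
`ℤ[1/S_f]^× = ±∏ p^ℤ`) and `v = q ∈ S_f`: entry `(p, q) = log |p|_q` with `|·|_q` the normalised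
`q`-adic absolute value (Mathlib's `padicNorm q`). The entries are computed, not posited; see
`sUnitRegulatorMatrix_eq_diagonal`. [cite: Tate1984Stark, Ch. I §2 (definition of R_S), p. 22] -/
noncomputable def sUnitRegulatorMatrix (S : Finset ℕ) : Matrix S S ℝ :=
  fun p q => Real.log ((padicNorm (q : ℕ) ((p : ℕ) : ℚ) : ℚ) : ℝ)

/-- Entries of the regulator matrix of `ℤ[1/S_f]`: `log |p|_p = −log p` and `log |p|_q = 0` for
primes `p ≠ q`. [cite: Tate1984Stark, Ch. I §2, p. 22] -/
theorem sUnitRegulatorMatrix_apply {S : Finset ℕ} (hS : ∀ p ∈ S, p.Prime) (p q : S) :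
    sUnitRegulatorMatrix S p q = if p = q then -Real.log (p : ℕ) else 0 := by
  haveI hpF : Fact (Nat.Prime (p : ℕ)) := ⟨hS p p.2⟩
  haveI hqF : Fact (Nat.Prime (q : ℕ)) := ⟨hS q q.2⟩
  unfold sUnitRegulatorMatrix
  split_ifs with hpq
  · subst hpq
    rw [padicNorm.padicNorm_p_of_prime]
    push_cast
    rw [Real.log_inv]
  · have hne : (q : ℕ) ≠ (p : ℕ) := fun h => hpq (Subtype.ext h.symm)
    rw [padicNorm.padicNorm_of_prime_of_ne hne]
    simp

/-- The regulator matrix of `ℤ[1/S_f]` in the basis `{p}_{p ∈ S_f}` is `−diag(log p)`.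
[cite: Tate1984Stark, Ch. I §2, p. 22] -/
theorem sUnitRegulatorMatrix_eq_diagonal {S : Finset ℕ} (hS : ∀ p ∈ S, p.Prime) :
    sUnitRegulatorMatrix S = -Matrix.diagonal fun p : S => Real.log (p : ℕ) := by
  ext p q
  rw [sUnitRegulatorMatrix_apply hS, Matrix.neg_apply, Matrix.diagonal_apply]
  split_ifs <;> simp

/-- The `S`-regulator `R_S = |det (log |u_i|_v)|` of `ℚ` for `S = {∞} ∪ S_f`, taken in the
`S`-unit basis `{p}_{p ∈ S_f}` with the archimedean place omitted.
[cite: Tate1984Stark, Ch. I §2 (definition of R_S), p. 22] -/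
noncomputable def sUnitRegulator (S : Finset ℕ) : ℝ := |(sUnitRegulatorMatrix S).det|

/-- `R_S(ℚ) = ∏_{p ∈ S_f} log p`. [cite: Tate1984Stark, Ch. I §2, p. 22] -/
theorem sUnitRegulator_eq_prod_log {S : Finset ℕ} (hS : ∀ p ∈ S, p.Prime) :
    sUnitRegulator S = ∏ p ∈ S, Real.log p := by
  rw [sUnitRegulator, sUnitRegulatorMatrix_eq_diagonal hS, Matrix.det_neg, Matrix.det_diagonal,
    abs_mul, abs_pow, abs_neg, abs_one, one_pow, one_mul, Finset.abs_prod,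
    ← Finset.prod_coe_sort S (fun p : ℕ => Real.log p)]
  refine Finset.prod_congr rfl fun p _ => abs_of_nonneg (Real.log_natCast_nonneg _)

/-- **The `S`-class number formula at `s = 0` for `ℚ`** in Tate's shape
`ζ_{k,S}(s) ∼ −(h_S R_S / w)·s^{card S − 1}`: for `k = ℚ`, `S = {∞} ∪ S_f` (`S_f` a finite set of
primes), `h_S = 1` (`ℤ[1/S_f]` is a principal ideal domain) and `w = 2` (`μ(ℚ) = {±1}`), so
`ζ_{ℚ,S}(s)/s^{|S_f|} → −R_S/2` with `R_S = ∏_{p ∈ S_f} log p` the `S`-regulator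
(`sUnitRegulator_eq_prod_log`). Equivalently (Tran, Prop. 4.8 with Thm. 1.1):
`ζ*_{ℚ,S}(0) = −χ_U(ℤ) = −h_S R_S/w`. [cite: Tate1984Stark, Ch. I §2 Cor. 2.2, pp. 22–23] -/
theorem tendsto_zetaRatS_classNumberFormula (S : Finset ℕ) (hS : ∀ p ∈ S, p.Prime) :
    Tendsto (fun s : ℂ => zetaRatS S s / s ^ S.card) (𝓝[≠] 0)
      (𝓝 (-(sUnitRegulator S : ℂ) / 2)) := by
  have h := tendsto_zetaRatS_div_pow_card S fun p hp => (hS p hp).pos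
  rw [sUnitRegulator_eq_prod_log hS, Complex.ofReal_prod]
  exact h

end Literature.NumberTheory.LFunctions
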